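import Summits.QuantumFields.BalabanUV.Beta.GAN24.PeriodicKKTExchangePairing
import Summits.QuantumFields.BalabanUV.Beta.GAN24.WilsonThreeFaceGraded

/-!
# (C)sym at level 0 — the exchange pairing of two EXIT-FACE currents as ONE number (blueprint link (E5))

WHAT. `PeriodicKKTExchangePairing.card_mul_pairing_plaq` evaluates the cell pairing `|box|·⟨J_{F′}, Γ_N·J_F⟩_cell` of the
currents `J_F = −½·curvAdj F` of two plaquette-column 2-forms — `F = p ⊗ q` on the `(γ, α)`-plaquettes (`γ ≠ α`), `F′ = p′ ⊗ q′`
on the `(γ′, α′)`-plaquettes — as `E·(−½·P′·P + ½·|box|·Σ_{r ∈ box} p′q′pq)`, `E = [γ′ = γ][α′ = α] − [γ′ = α][α′ = γ]`.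
In the level-0 (C)sym exchange word every profile is the EXIT-FACE INDICATOR `𝟙f(n) = [n % N = N − 1]` (the background-resummed
dressed half-vertices `DressedWilsonHalfVertex.hasSum_faceHalfVertex_fst ∕ _snd` are `∓½·c·curvAdj (𝟙f ⊗ 𝟙f)`), so the pairing
is ONE NUMBER. This file records it:

* §1 `face_periodic` (`𝟙f` is `N`-periodic), `face_mul_face` (`𝟙f² = 𝟙f`), `sum_box_face_mul_face` ∕ `_swap`
  (`Σ_{r ∈ box} 𝟙f(r_γ)·𝟙f(r_α) = N^{d−1}`, by `sum_box_mul_coord` and an3∕leaf's `WilsonThreeFaceGraded.sum_range_face_shift`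
  BY NAME), `sum_box_face4_same` ∕ `_swap` (the quartic cell sums that survive the factor `E`);
* §2 **`card_mul_pairing_face`**: `|box|·⟨J_{𝟙f⊗𝟙f on (γ′,α′)}, Γ_N·J_{𝟙f⊗𝟙f on (γ,α)}⟩_cell = E·½·N^{d−1}·(N^{d+1} − N^{d−1})`;
  **`pairing_face`**: `⟨J′, Γ_N·J⟩_cell = E·½·(1 − N⁻²)·N^{d−1}` (`|box| = N^{d+1}`; `d ≥ 1` is forced by `γ ≠ α`).

With the constants of `DressedWilsonHalfVertex` ∕ `DressedKernelOnCurrent` this is the value `EE(μν;αβ) = −K₁²·s_f²·E·½(1 − Lc⁻²)·Lc^{d−1}`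
of the blueprint (leaf-04 g65 §5); the composition itself is NOT done here.

HONEST: [folklore] finite cell algebra BY NAME over `card_mul_pairing_plaq`, `sum_box_mul_coord`, `sum_range_face_shift`; no value of
Bałaban's tables is asserted; (C)sym stays DISPLAYED — nothing of (C)∕(Q-D)∕(Q-D-rate) is discharged; NEVER «G-an2-4 closed» as (CONV-C);
NOT D1, NOT BetaPertH, NOT continuum, NOT Clay.
-/

noncomputable section

open Finset
open scoped BigOperators
open Literature.MathematicalPhysics.QuantumFieldTheory
open Literature.MathematicalPhysics.QuantumFieldTheory.Balaban1983to89.Beta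
open AffineAveraging (Form2 curvAdj box toSite)
open KKTFluctuationKernel (Gam)
open Summit.QuantumFields.BalabanUV.Beta.GAN24.PeriodicKKTExchangePairing (sum_box_mul_coord card_mul_pairing_plaq)
open Summit.QuantumFields.BalabanUV.Beta.GAN24.WilsonThreeFaceGraded (sum_range_face_shift)

namespace Summit.QuantumFields.BalabanUV.Beta.GAN24.FaceCurrentExchangeValue

variable {d N : ℕ}

/-! ## §1 The exit-face indicator and its cell sums -/

/-- [folklore] The exit-face indicator `𝟙f(n) = [n % N = N − 1]` is `N`-periodic. -/
theorem face_periodic (N : ℕ) (t k : ℤ) :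
    (if (t + (N : ℤ) * k) % (N : ℤ) = (N : ℤ) - 1 then (1 : ℝ) else 0) = (if t % (N : ℤ) = (N : ℤ) - 1 then (1 : ℝ) else 0) := by
  rw [Int.add_mul_emod_self_left]

/-- [folklore] `𝟙f(m)·𝟙f(n)·(𝟙f(m)·𝟙f(n)) = 𝟙f(m)·𝟙f(n)` (indicators are idempotent). -/
theorem face_mul_face (N : ℕ) (m n : ℤ) :
    (if m % (N : ℤ) = (N : ℤ) - 1 then (1 : ℝ) else 0) * (if n % (N : ℤ) = (N : ℤ) - 1 then (1 : ℝ) else 0) *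
        ((if m % (N : ℤ) = (N : ℤ) - 1 then (1 : ℝ) else 0) * (if n % (N : ℤ) = (N : ℤ) - 1 then (1 : ℝ) else 0)) =
      (if m % (N : ℤ) = (N : ℤ) - 1 then (1 : ℝ) else 0) * (if n % (N : ℤ) = (N : ℤ) - 1 then (1 : ℝ) else 0) := by
  split_ifs <;> norm_num

variable {γ α : Fin (d + 1)}

/-- [folklore] **TWO EXIT FACES MEET IN `N^{d−1}` CELL POINTS**: `Σ_{r ∈ box} 𝟙f(r_γ)·𝟙f(r_α) = N^{d−1}` (`γ ≠ α`, `1 ≤ N`). -/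
theorem sum_box_face_mul_face (hN : 1 ≤ N) (hγα : γ ≠ α) :
    ∑ r ∈ box (d + 1) N, (if toSite r γ % (N : ℤ) = (N : ℤ) - 1 then (1 : ℝ) else 0) * (if toSite r α % (N : ℤ) = (N : ℤ) - 1 then (1 : ℝ) else 0) =
      (N : ℝ) ^ (d - 1) := by
  have h1 : ∑ t ∈ Finset.range N, (if ((t : ℕ) : ℤ) % (N : ℤ) = (N : ℤ) - 1 then (1 : ℝ) else 0) = 1 := by
    have h := sum_range_face_shift (P := N) hN 0
    simp only [add_zero] at h
    exact h
  have h := sum_box_mul_coord (d := d) (N := N) hγα (fun n : ℤ => if n % (N : ℤ) = (N : ℤ) - 1 then (1 : ℝ) else 0)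
    (fun n : ℤ => if n % (N : ℤ) = (N : ℤ) - 1 then (1 : ℝ) else 0)
  simp only [h1, mul_one] at h
  exact h

/-- [folklore] The same with the factors swapped: `Σ_{r ∈ box} 𝟙f(r_α)·𝟙f(r_γ) = N^{d−1}`. -/
theorem sum_box_face_mul_face_swap (hN : 1 ≤ N) (hγα : γ ≠ α) :
    ∑ r ∈ box (d + 1) N, (if toSite r α % (N : ℤ) = (N : ℤ) - 1 then (1 : ℝ) else 0) * (if toSite r γ % (N : ℤ) = (N : ℤ) - 1 then (1 : ℝ) else 0) =
      (N : ℝ) ^ (d - 1) := by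
  rw [← sum_box_face_mul_face hN hγα]
  exact Finset.sum_congr rfl fun r _ => mul_comm _ _

/-- [folklore] The quartic cell sum of the diagonal case `(γ′, α′) = (γ, α)`: `Σ_{r ∈ box} 𝟙f(r_γ)𝟙f(r_α)·(𝟙f(r_γ)𝟙f(r_α)) = N^{d−1}`. -/
theorem sum_box_face4_same (hN : 1 ≤ N) (hγα : γ ≠ α) :
    ∑ r ∈ box (d + 1) N, (if toSite r γ % (N : ℤ) = (N : ℤ) - 1 then (1 : ℝ) else 0) * (if toSite r α % (N : ℤ) = (N : ℤ) - 1 then (1 : ℝ) else 0) *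
        ((if toSite r γ % (N : ℤ) = (N : ℤ) - 1 then (1 : ℝ) else 0) * (if toSite r α % (N : ℤ) = (N : ℤ) - 1 then (1 : ℝ) else 0)) =
      (N : ℝ) ^ (d - 1) := by
  rw [← sum_box_face_mul_face hN hγα]
  exact Finset.sum_congr rfl fun r _ => face_mul_face N _ _

/-- [folklore] The quartic cell sum of the crossed case `(γ′, α′) = (α, γ)`: `Σ_{r ∈ box} 𝟙f(r_α)𝟙f(r_γ)·(𝟙f(r_γ)𝟙f(r_α)) = N^{d−1}`. -/
theorem sum_box_face4_swap (hN : 1 ≤ N) (hγα : γ ≠ α) :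
    ∑ r ∈ box (d + 1) N, (if toSite r α % (N : ℤ) = (N : ℤ) - 1 then (1 : ℝ) else 0) * (if toSite r γ % (N : ℤ) = (N : ℤ) - 1 then (1 : ℝ) else 0) *
        ((if toSite r γ % (N : ℤ) = (N : ℤ) - 1 then (1 : ℝ) else 0) * (if toSite r α % (N : ℤ) = (N : ℤ) - 1 then (1 : ℝ) else 0)) =
      (N : ℝ) ^ (d - 1) := by
  rw [← sum_box_face_mul_face hN hγα]
  refine Finset.sum_congr rfl fun r _ => ?_
  rw [mul_comm (if toSite r α % (N : ℤ) = (N : ℤ) - 1 then (1 : ℝ) else 0) (if toSite r γ % (N : ℤ) = (N : ℤ) - 1 then (1 : ℝ) else 0)]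
  exact face_mul_face N _ _

/-! ## §2 The pairing of two exit-face currents -/

/-- [folklore] **THE EXCHANGE PAIRING OF TWO EXIT-FACE CURRENTS** (`γ ≠ α`, any `(γ′, α′)`, `N ≥ 1`):
`|box|·Σ_{r ∈ box} Σ_μ J′ μ r·(Γ_N·J) μ r = E·½·N^{d−1}·(N^{d+1} − N^{d−1})`, where `J = −½·curvAdj (𝟙f ⊗ 𝟙f on (γ, α))`,
`J′ = −½·curvAdj (𝟙f ⊗ 𝟙f on (γ′, α′))`, `E = [γ′ = γ][α′ = α] − [γ′ = α][α′ = γ]` — `card_mul_pairing_plaq` with all four profiles `𝟙f`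
(`P = P′ = N^{d−1}` and the quartic cell sum `= N^{d−1}` whenever `E ≠ 0`). -/
theorem card_mul_pairing_face [NeZero N] (hγα : γ ≠ α) {γ' α' : Fin (d + 1)} :
    ((box (d + 1) N).card : ℝ) * ∑ r ∈ box (d + 1) N, ∑ μ,
        (-(1 / 2 : ℝ) * curvAdj (fun κ l (x : AffineAveraging.Site (d + 1)) =>
          (if κ = γ' ∧ l = α' then (if x γ' % (N : ℤ) = (N : ℤ) - 1 then (1 : ℝ) else 0) * (if x α' % (N : ℤ) = (N : ℤ) - 1 then (1 : ℝ) else 0) else 0) -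
          (if κ = α' ∧ l = γ' then (if x γ' % (N : ℤ) = (N : ℤ) - 1 then (1 : ℝ) else 0) * (if x α' % (N : ℤ) = (N : ℤ) - 1 then (1 : ℝ) else 0) else 0))
          μ (toSite r)) *
        (∑' y, ∑ l, (-(1 / 2 : ℝ) * curvAdj (fun κ l (x : AffineAveraging.Site (d + 1)) =>
          (if κ = γ ∧ l = α then (if x γ % (N : ℤ) = (N : ℤ) - 1 then (1 : ℝ) else 0) * (if x α % (N : ℤ) = (N : ℤ) - 1 then (1 : ℝ) else 0) else 0) -
          (if κ = α ∧ l = γ then (if x γ % (N : ℤ) = (N : ℤ) - 1 then (1 : ℝ) else 0) * (if x α % (N : ℤ) = (N : ℤ) - 1 then (1 : ℝ) else 0) else 0)) l y) *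
          Gam (N := N) μ (toSite r) l y) =
      ((if γ' = γ ∧ α' = α then (1 : ℝ) else 0) - (if γ' = α ∧ α' = γ then (1 : ℝ) else 0)) *
        ((1 / 2 : ℝ) * (N : ℝ) ^ (d - 1) * ((N : ℝ) ^ (d + 1) - (N : ℝ) ^ (d - 1))) := by
  classical
  have hN : 1 ≤ N := Nat.one_le_iff_ne_zero.mpr (NeZero.ne N)
  have hper : ∀ t (k : ℤ), (fun n : ℤ => if n % (N : ℤ) = (N : ℤ) - 1 then (1 : ℝ) else 0) (t + (N : ℤ) * k) =
      (fun n : ℤ => if n % (N : ℤ) = (N : ℤ) - 1 then (1 : ℝ) else 0) t := fun t k => face_periodic N t k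
  have hcard : ((box (d + 1) N).card : ℝ) = (N : ℝ) ^ (d + 1) := by
    have h : (box (d + 1) N).card = N ^ (d + 1) := by
      simp [AffineAveraging.box, Fintype.card_piFinset, Finset.card_range, Finset.prod_const, Finset.card_univ, Fintype.card_fin]
    rw [h]; push_cast; rfl
  have h := card_mul_pairing_plaq (N := N) hγα (γ' := γ') (α' := α')
    (fun n : ℤ => if n % (N : ℤ) = (N : ℤ) - 1 then (1 : ℝ) else 0) (fun n : ℤ => if n % (N : ℤ) = (N : ℤ) - 1 then (1 : ℝ) else 0)
    (fun n : ℤ => if n % (N : ℤ) = (N : ℤ) - 1 then (1 : ℝ) else 0) (fun n : ℤ => if n % (N : ℤ) = (N : ℤ) - 1 then (1 : ℝ) else 0) hper hper hper hper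
  beta_reduce at h
  rw [h, hcard]
  by_cases h1 : γ' = γ ∧ α' = α
  · obtain ⟨rfl, rfl⟩ := h1
    rw [if_pos ⟨rfl, rfl⟩, if_neg (fun h => hγα h.1), sum_box_face_mul_face hN hγα, sum_box_face4_same hN hγα]
    ring
  · by_cases h2 : γ' = α ∧ α' = γ
    · obtain ⟨rfl, rfl⟩ := h2
      rw [if_neg h1, if_pos ⟨rfl, rfl⟩, sum_box_face_mul_face_swap hN hγα, sum_box_face_mul_face hN hγα, sum_box_face4_swap hN hγα]
      ring
    · rw [if_neg h1, if_neg h2]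
      ring

/-- [folklore] **THE EXCHANGE NUMBER** (`γ ≠ α`, any `(γ′, α′)`, `N ≥ 1`; `|box| = N^{d+1}` divided out, `d ≥ 1` being forced by `γ ≠ α`):
`⟨J′, Γ_N·J⟩_cell = Σ_{r ∈ box} Σ_μ J′ μ r·(Γ_N·J) μ r = E·½·(1 − N⁻²)·N^{d−1}` — the number `⟨J_{F_{μα}}, A_{F_{νβ}}⟩_cell` of blueprint g65 §5. -/
theorem pairing_face [NeZero N] (hγα : γ ≠ α) {γ' α' : Fin (d + 1)} :
    ∑ r ∈ box (d + 1) N, ∑ μ,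
        (-(1 / 2 : ℝ) * curvAdj (fun κ l (x : AffineAveraging.Site (d + 1)) =>
          (if κ = γ' ∧ l = α' then (if x γ' % (N : ℤ) = (N : ℤ) - 1 then (1 : ℝ) else 0) * (if x α' % (N : ℤ) = (N : ℤ) - 1 then (1 : ℝ) else 0) else 0) -
          (if κ = α' ∧ l = γ' then (if x γ' % (N : ℤ) = (N : ℤ) - 1 then (1 : ℝ) else 0) * (if x α' % (N : ℤ) = (N : ℤ) - 1 then (1 : ℝ) else 0) else 0))
          μ (toSite r)) *
        (∑' y, ∑ l, (-(1 / 2 : ℝ) * curvAdj (fun κ l (x : AffineAveraging.Site (d + 1)) =>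
          (if κ = γ ∧ l = α then (if x γ % (N : ℤ) = (N : ℤ) - 1 then (1 : ℝ) else 0) * (if x α % (N : ℤ) = (N : ℤ) - 1 then (1 : ℝ) else 0) else 0) -
          (if κ = α ∧ l = γ then (if x γ % (N : ℤ) = (N : ℤ) - 1 then (1 : ℝ) else 0) * (if x α % (N : ℤ) = (N : ℤ) - 1 then (1 : ℝ) else 0) else 0)) l y) *
          Gam (N := N) μ (toSite r) l y) =
      ((if γ' = γ ∧ α' = α then (1 : ℝ) else 0) - (if γ' = α ∧ α' = γ then (1 : ℝ) else 0)) *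
        ((1 / 2 : ℝ) * (1 - ((N : ℝ) ^ 2)⁻¹) * (N : ℝ) ^ (d - 1)) := by
  have h := card_mul_pairing_face (N := N) hγα (γ' := γ') (α' := α')
  have hcard : ((box (d + 1) N).card : ℝ) = (N : ℝ) ^ (d + 1) := by
    have h' : (box (d + 1) N).card = N ^ (d + 1) := by
      simp [AffineAveraging.box, Fintype.card_piFinset, Finset.card_range, Finset.prod_const, Finset.card_univ, Fintype.card_fin]
    rw [h']; push_cast; rfl
  have hN0 : (N : ℝ) ≠ 0 := Nat.cast_ne_zero.2 (NeZero.ne N)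
  have hd : 1 ≤ d := by
    by_contra h0
    have hγ := γ.isLt
    have hα := α.isLt
    exact hγα (Fin.ext (by omega))
  have hpow : (N : ℝ) ^ (d + 1) = (N : ℝ) ^ (d - 1) * (N : ℝ) ^ 2 := by
    rw [← pow_add]; congr 1; omega
  rw [hcard] at h
  have hp : (N : ℝ) ^ (d + 1) ≠ 0 := pow_ne_zero _ hN0
  refine mul_left_cancel₀ hp ?_
  rw [h, hpow]
  field_simp

end Summit.QuantumFields.BalabanUV.Beta.GAN24.FaceCurrentExchangeValue

end
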